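import Summits.BirchSwinnertonDyer.Rank1Residual.F1Sign2.OddBranchFEAtTwoTransport
import HarnessLib

/-!
# `OddBranchFunctionalEquationAtTwo` — Part 4 (headline) of the odd-branch functional equation at `2` (g3): §7 the functional equations
`L♯₋(ιT) = s·(1+T)^{c+a}·L♯₋(T)`, `L♭₋(ιT) = s·(1+T)^{c+b}·L♭₋(T)` for EVERY odd-branch Sprung pair
`IsSprungPairOdd f 2 0 L♯₋ L♭₋` of a rational newform of odd level (`a₂ = 0` weights), with the sign
`s = −σ·χ₄(N)` at form level and `s = −w_E·χ₄(N_E) = w(E^{(−1)})` at conductor level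
(`subst_invOnePlusSubOne_eq_rootNumber_chi4_of_isSprungPairOdd_two`,
`exists_isSprungPairOdd_two_functionalEquation`). In print: Sprung, arXiv:1211.1352, Thm. 3.16 /
Cor. 3.17 (every good prime, every tame character). See Part 1 for the overview and references.

TURNKEY filing by the typer seat `bsd-f1-sign2-ty` (D-ty-6, part 4/6 of -an g3's kernel file `OddFE.lean`
200de6ab6bb130d9, pre-split by the planner): `HOME/MEMO-an-data/g3/split/OddBranchFunctionalEquationAtTwo.lean` sha16 33fe1cc9e005da1d
(joint farm checks `JointA_parts1to4` 000c30d5de228c06 / `JointB_parts1to6` cbbe6a2064807d53: rc 0, 0 warnings, 0 sorries),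
re-filed VERBATIM. PROOF-ONLY module (theorems; no definition, no named fact). REF2-PLACEMENT-v8 §0: the odd-branch
functional equation at 2 is IN PRINT (Sprung, ANT 11 (2017), Cor. 4.14 at (p, i) = (2, 1); Sprung arXiv:1211.1352 Thm 3.16 /
Cor 3.17) — formalised here, not new; beyond-print theorem: no for the FE itself (value corollaries: REF2 placing).
-/

set_option autoImplicit false

noncomputable section

open scoped MatrixGroups ModularForm

open CongruenceSubgroup PowerSeries Filter Topology
  Literature.NumberTheory.EllipticCurves Literature.NumberTheory.EllipticCurves.ModularForms
  Literature.NumberTheory.EllipticCurves.Sprung2017 Literature.Barriers.BirchSwinnertonDyer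

namespace Summit.BirchSwinnertonDyer.Rank1Residual.F1Sign2

/-! ## §7. The functional equations of `L♯₋` and `L♭₋` (`p = 2`, weights of `a₂ = 0`) -/

section FunctionalEquation

variable {N : ℕ} [NeZero N] (f : CuspForm (Gamma0 N) 2)

/-- **The functional equations of the ODD-branch pair `(L♯₋, L♭₋)` at `2`, in `Λ = ℤ₂⟦T⟧, any odd
level, any pair.** Let `f ∈ S₂(Γ₀(N))` be rational (`coeffField f = ⊥`), `2 ∤ N`, `f|w_N = −σ f`
(`σ² = 1`), `N = η_N · 5^c` in `ℤ₂^×` (`c ∈ ℤ₂`) with `η_N = e ∈ {±1}` (`= χ₄(N)`,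
`coe_rootsOfUnity_eq_chi4`), `3a = −2`, `3b = −1`. If `(L♯₋, L♭₋)` satisfies the odd congruences
`θ⁻_n ≡ −(u_n L♯₋ + v_n L♭₋) (mod ω_n)` for all `n` (`IsSprungPairOdd f 2 0`), then
`L♯₋(T^ι) = −σe · (1+T)^{c+a} · L♯₋(T)` and `L♭₋(T^ι) = −σe · (1+T)^{c+b} · L♭₋(T)`.
The sign `−σ·η_N` versus the even branch's `σ`: the extra `χ₋₄(−N) = −χ₄(N)` of
Mazur–Tate–Teitelbaum's `c_N ε̄_f χ(−N)` for `χ = χ₋₄`. Proof: finite-level functional equation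
(`exists_two_mul_mazurTateElementOdd_fe`), transport (`isSprungPairOdd_two_zero_transport`),
uniqueness of the odd pair (`IsSprungPairOdd.unique`). NO hypothesis on `a₂(f)` is needed for the
implication (for `a₂(f) ≠ 0` no such pair need exist).
[cite: Sprung2017, Cor. 4.14 and §3.5 (functional equation, a_p = 0), Thm. 1.12 ("Fix a tame character ω^i")]
[cite: MazurTateTeitelbaum1986Invent, §I.17 (functional equation of θ(χ,T): sign c_N ε̄ χ(−N)) and §I.13]
[cite: GreenbergLNM1716, §1 (pp. 67–68)] -/
theorem subst_invOnePlusSubOne_eq_of_isSprungPairOdd_two (hQ : coeffField f = ⊥) (hN : ¬ 2 ∣ N)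
    {σ : ℤ} (hσ : σ ^ 2 = 1) (hW : IsFrickeEigen N f (-(σ : ℂ)))
    {ηN : rootsOfUnity (torsionOrder 2) ℤ_[2]} {c : ℤ_[2]}
    (hc : ∀ n : ℕ, PadicInt.toZModPow (n + cyclotomicExponent 2) ((ηN : ℤ_[2]ˣ) : ℤ_[2]) *
      (cyclotomicGenerator 2 : ZMod (2 ^ (n + cyclotomicExponent 2))) ^
        (PadicInt.toZModPow n c).val = (N : ZMod (2 ^ (n + cyclotomicExponent 2))))
    {e : ℤ} (he : ((ηN : ℤ_[2]ˣ) : ℤ_[2]) = e) {a b : ℤ_[2]} (ha : 3 * a = -2) (hb : 3 * b = -1)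
    {Ls Lf : IwasawaAlgebra 2} (h : IsSprungPairOdd f 2 0 Ls Lf) :
    Ls.subst (invOnePlusSubOne : ℤ_[2]⟦X⟧) =
        ((-(σ * e) : ℤ) : IwasawaAlgebra 2) * PowerSeries.binomialSeries ℤ_[2] (c + a) * Ls ∧
      Lf.subst (invOnePlusSubOne : ℤ_[2]⟦X⟧) =
        ((-(σ * e) : ℤ) : IwasawaAlgebra 2) * PowerSeries.binomialSeries ℤ_[2] (c + b) * Lf := by
  have he1 : e = 1 ∨ e = -1 := eq_one_or_eq_neg_one_of_coe_rootsOfUnity_eq he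
  have hε2 : (-(σ * e)) ^ 2 = 1 := by
    rcases he1 with h1 | h1 <;> rw [h1] <;> linear_combination hσ
  have h' := isSprungPairOdd_two_zero_transport (f := f) hε2 ha hb
    (fun m ↦ exists_two_mul_mazurTateElementOdd_fe f hQ hN hσ hW hc he m) h
  obtain ⟨hs, hf'⟩ := IsSprungPairOdd.unique (dvd_zero 2) h h'
  exact ⟨subst_invOnePlusSubOne_eq_of_eq_mul_subst hε2 hs,
    subst_invOnePlusSubOne_eq_of_eq_mul_subst hε2 hf'⟩

/-- **The odd-branch functional equations read in `ℚ₂⟦T⟧** (the shape used by the parity / value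
arguments): `(ι_Λ L♯₋)(T^ι) = C(−σe) · (1+T)^{c+a} · ι_Λ L♯₋`, `(ι_Λ L♭₋)(T^ι) = C(−σe) · (1+T)^{c+b} · ι_Λ L♭₋`.
[cite: Sprung2017, Cor. 4.14, Thm. 1.12] [cite: MazurTateTeitelbaum1986Invent, §I.17] -/
theorem subst_iwasawaToPowerSeries_eq_of_isSprungPairOdd_two (hQ : coeffField f = ⊥) (hN : ¬ 2 ∣ N)
    {σ : ℤ} (hσ : σ ^ 2 = 1) (hW : IsFrickeEigen N f (-(σ : ℂ)))
    {ηN : rootsOfUnity (torsionOrder 2) ℤ_[2]} {c : ℤ_[2]}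
    (hc : ∀ n : ℕ, PadicInt.toZModPow (n + cyclotomicExponent 2) ((ηN : ℤ_[2]ˣ) : ℤ_[2]) *
      (cyclotomicGenerator 2 : ZMod (2 ^ (n + cyclotomicExponent 2))) ^
        (PadicInt.toZModPow n c).val = (N : ZMod (2 ^ (n + cyclotomicExponent 2))))
    {e : ℤ} (he : ((ηN : ℤ_[2]ˣ) : ℤ_[2]) = e) {a b : ℤ_[2]} (ha : 3 * a = -2) (hb : 3 * b = -1)
    {Ls Lf : IwasawaAlgebra 2} (h : IsSprungPairOdd f 2 0 Ls Lf) :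
    (iwasawaToPowerSeries 2 Ls).subst (invOnePlusSubOne : ℚ_[2]⟦X⟧) =
        C ((-(σ * e) : ℤ) : ℚ_[2]) * PowerSeries.binomialSeries ℚ_[2] (c + a) *
          iwasawaToPowerSeries 2 Ls ∧
      (iwasawaToPowerSeries 2 Lf).subst (invOnePlusSubOne : ℚ_[2]⟦X⟧) =
        C ((-(σ * e) : ℤ) : ℚ_[2]) * PowerSeries.binomialSeries ℚ_[2] (c + b) *
          iwasawaToPowerSeries 2 Lf := by
  obtain ⟨hs, hf'⟩ := subst_invOnePlusSubOne_eq_of_isSprungPairOdd_two f hQ hN hσ hW hc he ha hb h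
  exact ⟨subst_iwasawaToPowerSeries_eq_of_subst_eq hs, subst_iwasawaToPowerSeries_eq_of_subst_eq hf'⟩

/-- **The odd-branch functional equations with the sign written `−σ·χ₄(N)`** (`η_N = χ₄(N)`,
`coe_rootsOfUnity_eq_chi4`): `L♯₋(T^ι) = −σχ₄(N) (1+T)^{c+a} L♯₋`, `L♭₋(T^ι) = −σχ₄(N) (1+T)^{c+b} L♭₋`.
[cite: MazurTateTeitelbaum1986Invent, §I.17 (sign c_N ε̄ χ(−N), χ = χ₋₄)] [cite: Sprung2017, Cor. 4.14] -/
theorem subst_invOnePlusSubOne_eq_chi4_of_isSprungPairOdd_two (hQ : coeffField f = ⊥) (hN : ¬ 2 ∣ N)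
    {σ : ℤ} (hσ : σ ^ 2 = 1) (hW : IsFrickeEigen N f (-(σ : ℂ)))
    {ηN : rootsOfUnity (torsionOrder 2) ℤ_[2]} {c : ℤ_[2]}
    (hc : ∀ n : ℕ, PadicInt.toZModPow (n + cyclotomicExponent 2) ((ηN : ℤ_[2]ˣ) : ℤ_[2]) *
      (cyclotomicGenerator 2 : ZMod (2 ^ (n + cyclotomicExponent 2))) ^
        (PadicInt.toZModPow n c).val = (N : ZMod (2 ^ (n + cyclotomicExponent 2))))
    {a b : ℤ_[2]} (ha : 3 * a = -2) (hb : 3 * b = -1)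
    {Ls Lf : IwasawaAlgebra 2} (h : IsSprungPairOdd f 2 0 Ls Lf) :
    Ls.subst (invOnePlusSubOne : ℤ_[2]⟦X⟧) =
        ((-(σ * ZMod.χ₄ (N : ZMod 4)) : ℤ) : IwasawaAlgebra 2) *
          PowerSeries.binomialSeries ℤ_[2] (c + a) * Ls ∧
      Lf.subst (invOnePlusSubOne : ℤ_[2]⟦X⟧) =
        ((-(σ * ZMod.χ₄ (N : ZMod 4)) : ℤ) : IwasawaAlgebra 2) *
          PowerSeries.binomialSeries ℤ_[2] (c + b) * Lf :=
  subst_invOnePlusSubOne_eq_of_isSprungPairOdd_two f hQ hN hσ hW hc (coe_rootsOfUnity_eq_chi4 hc)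
    ha hb h

/-- **Existence form, any odd level, curve-free**: for a rational newform `f ∈ S₂(Γ₀(N))`, `2 ∤ N`,
there are `σ = ±1` with `σ = −ε(f)` (`ε(f)` the Atkin–Lehner eigenvalue), a `2`-adic exponent `c`
and Teichmüller part `η_N = χ₄(N)` of `N`, and `a, b ∈ ℤ₂` with `3a = −2`, `3b = −1`, such that
EVERY odd Sprung pair (weights of `a₂ = 0`) satisfies `L♯₋(T^ι) = −σχ₄(N)(1+T)^{c+a}L♯₋`,
`L♭₋(T^ι) = −σχ₄(N)(1+T)^{c+b}L♭₋`. [cite: Sprung2017, Cor. 4.14, Thm. 1.12]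
[cite: MazurTateTeitelbaum1986Invent, §I.17] [cite: GreenbergLNM1716, §1 (pp. 67–68)] -/
theorem exists_functionalEquation_sharp_flat_odd_two (hf0 : IsNewform0 f) (hQ : coeffField f = ⊥)
    (hN : ¬ 2 ∣ N) :
    ∃ σ : ℤ, (σ = 1 ∨ σ = -1) ∧ (σ : ℂ) = -frickeEigenvalue f ∧
      ∃ (ηN : rootsOfUnity (torsionOrder 2) ℤ_[2]) (c a b : ℤ_[2]),
        (∀ n : ℕ, PadicInt.toZModPow (n + cyclotomicExponent 2) ((ηN : ℤ_[2]ˣ) : ℤ_[2]) *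
          (cyclotomicGenerator 2 : ZMod (2 ^ (n + cyclotomicExponent 2))) ^
            (PadicInt.toZModPow n c).val = (N : ZMod (2 ^ (n + cyclotomicExponent 2)))) ∧
        ((ηN : ℤ_[2]ˣ) : ℤ_[2]) = ((ZMod.χ₄ (N : ZMod 4) : ℤ) : ℤ_[2]) ∧
        3 * a = -2 ∧ 3 * b = -1 ∧
        ∀ Ls Lf : IwasawaAlgebra 2, IsSprungPairOdd f 2 0 Ls Lf →
          Ls.subst (invOnePlusSubOne : ℤ_[2]⟦X⟧) =
              ((-(σ * ZMod.χ₄ (N : ZMod 4)) : ℤ) : IwasawaAlgebra 2) *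
                PowerSeries.binomialSeries ℤ_[2] (c + a) * Ls ∧
            Lf.subst (invOnePlusSubOne : ℤ_[2]⟦X⟧) =
              ((-(σ * ZMod.χ₄ (N : ZMod 4)) : ℤ) : IwasawaAlgebra 2) *
                PowerSeries.binomialSeries ℤ_[2] (c + b) * Lf := by
  have hsm := IsNewform0.frickeInvolution_eq_smul_holds (N := N) (k := (2 : ℤ)) hf0
  have hFE : IsFrickeEigen N f (frickeEigenvalue f) :=
    isFrickeEigen_of_frickeInvolution_eq_smul N hsm
  obtain ⟨ηN, c, hc⟩ := exists_teichmuller_exponent_natCast 2 hN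
  obtain ⟨a, ha⟩ := exists_three_mul_eq (-2)
  obtain ⟨b, hb⟩ := exists_three_mul_eq (-1)
  have hη := coe_rootsOfUnity_eq_chi4 hc
  rcases IsNewform0.frickeEigenvalue_eq_one_or_eq_neg_one_holds (N := N) (k := (2 : ℤ)) hf0 with
    h1 | h1
  · have hW : IsFrickeEigen N f (-((-1 : ℤ) : ℂ)) := by
      have : (-((-1 : ℤ) : ℂ)) = frickeEigenvalue f := by rw [h1]; push_cast; ring
      rw [this]; exact hFE
    exact ⟨-1, Or.inr rfl, by rw [h1]; push_cast; ring, ηN, c, a, b, hc, hη, ha, hb, fun Ls Lf h ↦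
      subst_invOnePlusSubOne_eq_chi4_of_isSprungPairOdd_two f hQ hN (by norm_num) hW hc ha hb h⟩
  · have hW : IsFrickeEigen N f (-((1 : ℤ) : ℂ)) := by
      have : (-((1 : ℤ) : ℂ)) = frickeEigenvalue f := by rw [h1]; push_cast; ring
      rw [this]; exact hFE
    exact ⟨1, Or.inl rfl, by rw [h1]; push_cast; ring, ηN, c, a, b, hc, hη, ha, hb, fun Ls Lf h ↦
      subst_invOnePlusSubOne_eq_chi4_of_isSprungPairOdd_two f hQ hN (by norm_num) hW hc ha hb h⟩

end FunctionalEquation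

section ConductorLevel

variable {W : WeierstrassCurve ℚ} [W.IsElliptic] [W.IsGloballyMinimal] [NeZero (W.conductorNorm ℤ)]
  {f : CuspForm (Gamma0 (W.conductorNorm ℤ)) 2}

/-- **At the conductor level the sign is `−w_E · χ₄(N_E) = w_E · χ₋₄(−N_E) = w(E ⊗ χ₋₄)`**: for
`f ∈ S₂(Γ₀(N_W))` the newform of the globally minimal `W` with good reduction at `2` (`2 ∤ N_W`),
`N_W = η 5^c`, `3a = −2`, `3b = −1`, every odd Sprung pair (weights of `a₂ = 0`; it exists iff … —
existence for `a₂(W) = 0` is `exists_isSprungPairOdd_two`) satisfies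
`L♯₋(T^ι) = −w_E χ₄(N_W) (1+T)^{c+a} L♯₋`, `L♭₋(T^ι) = −w_E χ₄(N_W) (1+T)^{c+b} L♭₋`
(`w_E = −ε(f)`: `rootNumber_eq_neg_frickeEigenvalue`). The sign is the root number of the twist
`E^{(−1)}` (`w(E ⊗ χ_d) = χ_d(−N_E) w(E)` for `(d, N_E) = 1`), as Greenberg's "the signs are the same"
predicts for the `χ₋₄`-branch. [cite: GreenbergLNM1716, §1 (pp. 67–68)]
[cite: MazurTateTeitelbaum1986Invent, §I.17] [cite: Sprung2017, Cor. 4.14, Thm. 1.12] -/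
theorem subst_invOnePlusSubOne_eq_rootNumber_chi4_of_isSprungPairOdd_two (hf : IsNewformOf W f)
    (hgood : W.HasGoodReductionAtPrime 2)
    {ηN : rootsOfUnity (torsionOrder 2) ℤ_[2]} {c : ℤ_[2]}
    (hc : ∀ n : ℕ, PadicInt.toZModPow (n + cyclotomicExponent 2) ((ηN : ℤ_[2]ˣ) : ℤ_[2]) *
      (cyclotomicGenerator 2 : ZMod (2 ^ (n + cyclotomicExponent 2))) ^
        (PadicInt.toZModPow n c).val =
          (W.conductorNorm ℤ : ZMod (2 ^ (n + cyclotomicExponent 2))))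
    {a b : ℤ_[2]} (ha : 3 * a = -2) (hb : 3 * b = -1) {Ls Lf : IwasawaAlgebra 2}
    (h : IsSprungPairOdd f 2 0 Ls Lf) :
    Ls.subst (invOnePlusSubOne : ℤ_[2]⟦X⟧) =
        ((-(W.rootNumber * ZMod.χ₄ (W.conductorNorm ℤ : ZMod 4)) : ℤ) : IwasawaAlgebra 2) *
          PowerSeries.binomialSeries ℤ_[2] (c + a) * Ls ∧
      Lf.subst (invOnePlusSubOne : ℤ_[2]⟦X⟧) =
        ((-(W.rootNumber * ZMod.χ₄ (W.conductorNorm ℤ : ZMod 4)) : ℤ) : IwasawaAlgebra 2) *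
          PowerSeries.binomialSeries ℤ_[2] (c + b) * Lf := by
  have hw : (W.rootNumber : ℂ) = -frickeEigenvalue f :=
    rootNumber_eq_neg_frickeEigenvalue (fun _ _ ↦ IsNewform0.exists_functional_equation_holds)
      (fun _ _ ↦ IsNewform0.frickeEigenvalue_eq_one_or_eq_neg_one_holds) hf
  have hsm := IsNewform0.frickeInvolution_eq_smul_holds (N := W.conductorNorm ℤ) (k := (2 : ℤ)) hf.1
  have hFE : IsFrickeEigen (W.conductorNorm ℤ) f (frickeEigenvalue f) :=
    isFrickeEigen_of_frickeInvolution_eq_smul _ hsm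
  have hW : IsFrickeEigen (W.conductorNorm ℤ) f (-((W.rootNumber : ℤ) : ℂ)) := by
    rw [hw, neg_neg]; exact hFE
  have hσ : W.rootNumber ^ 2 = 1 := by
    rcases W.rootNumber_eq_one_or with h | h <;> rw [h] <;> norm_num
  exact subst_invOnePlusSubOne_eq_chi4_of_isSprungPairOdd_two f hf.coeffField_eq_bot
    (not_dvd_level_of_isNewformOf hf hgood) hσ hW hc ha hb h

/-- **Packaged form for an elliptic curve with `a₂ = 0`**: existence (`exists_isSprungPairOdd_two`)
and the functional equation together — there is an odd Sprung pair `(L♯₋, L♭₋)` of `f` at `2`, and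
it (indeed every such pair) satisfies the functional equations with sign `−w_E χ₄(N_W)`.
[cite: Sprung2017, Thm. 1.12, Cor. 4.4, Cor. 4.14] [cite: GreenbergLNM1716, §1 (pp. 67–68)] -/
theorem exists_isSprungPairOdd_two_functionalEquation (hf : IsNewformOf W f)
    (hgood : W.HasGoodReductionAtPrime 2) (ha0 : W.frobeniusTrace 2 = 0)
    {ηN : rootsOfUnity (torsionOrder 2) ℤ_[2]} {c : ℤ_[2]}
    (hc : ∀ n : ℕ, PadicInt.toZModPow (n + cyclotomicExponent 2) ((ηN : ℤ_[2]ˣ) : ℤ_[2]) *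
      (cyclotomicGenerator 2 : ZMod (2 ^ (n + cyclotomicExponent 2))) ^
        (PadicInt.toZModPow n c).val =
          (W.conductorNorm ℤ : ZMod (2 ^ (n + cyclotomicExponent 2))))
    {a b : ℤ_[2]} (ha : 3 * a = -2) (hb : 3 * b = -1) :
    ∃ Ls Lf : IwasawaAlgebra 2, IsSprungPairOdd f 2 0 Ls Lf ∧
      Ls.subst (invOnePlusSubOne : ℤ_[2]⟦X⟧) =
          ((-(W.rootNumber * ZMod.χ₄ (W.conductorNorm ℤ : ZMod 4)) : ℤ) : IwasawaAlgebra 2) *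
            PowerSeries.binomialSeries ℤ_[2] (c + a) * Ls ∧
        Lf.subst (invOnePlusSubOne : ℤ_[2]⟦X⟧) =
          ((-(W.rootNumber * ZMod.χ₄ (W.conductorNorm ℤ : ZMod 4)) : ℤ) : IwasawaAlgebra 2) *
            PowerSeries.binomialSeries ℤ_[2] (c + b) * Lf := by
  have hap : (2 : ℤ) ∣ W.frobeniusTrace 2 := by rw [ha0]; exact dvd_zero 2
  obtain ⟨Ls, Lf, h⟩ := exists_isSprungPairOdd_two hf hgood hap
  rw [ha0] at h
  exact ⟨Ls, Lf, h, subst_invOnePlusSubOne_eq_rootNumber_chi4_of_isSprungPairOdd_two hf hgood hc ha hb h⟩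

end ConductorLevel

end Summit.BirchSwinnertonDyer.Rank1Residual.F1Sign2

end
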